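import Summits.BirchSwinnertonDyer.Rank1Residual.ManinAdditive.NeronOmegaThreeTrace
import HarnessLib
import HarnessLib.Audit.Tags

/-!
# «Ω = FRICKE-TRACE INTEGRALITY» at `9 ∥ N` / `27 ∥ N` (E-imc-160a/b), the PAIR law at 3 (E-imc-149) and its odd half the
# TWIST law (E-imc-159), the modular-degree law E-imc-161 — typed (imc g21, MEMO-imc §27; cell `bsd-f2-manin`, T-imc-28, typer g16)

TYPER FRAMING.  LENS = imc (planner-of-record `bsd-f2-manin-imc` g21; MEMO-imc §27, HOME/imc/PROOFS-g21.md sha16 36b758003d9249b2;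
crux idea `fricke-trace-omega-3` on stmt-BirchSwinnertonDyer-22968, commit 1e8c46f9d2f7).  SOURCE = HOME/imc/Sketch-imc-g21.lean sha16
**13e94d7737ddb003** (185 l.; imports `…NeronOmegaThreeTrace` only; farm rc 0 · 0 sorries · 0 warnings per imc; BC7 6/6 CLEAN
HOME/imc/g21-bc7.raw.txt / g21-bc7b.raw.txt), landed VERBATIM except: (i) this header (imc's module docstring is kept below);
(ii) namespace `…ManinAdditive.NeronOmegaThree` (the sketch's `NeronOmegaThreeG21`; imc: «or fold into the NeronOmegaThree ns» —
all names were free); (iii) nothing else.  NOTHING IS ASSERTED: six `@[conjecture]` obligation nodes — `TraceTranslateIdentityAtThree`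
(SUPPORT: a routine coset identity, = Literature `coe_adjDegeneracyMap0_one_three_mul_eq_sum` (p678484) + `w_N (1 −j/3; 0 1) w_N =
−N·(1 0; jM 1)` + weight-2 scalar triviality; a Lean proof is owed, not a crux), **E-imc-149 `PairLawAtThree`** (first typing of PAIR(3,2)),
**E-imc-159 `TwistLawAtThree`**, **E-imc-160a `OmegaEqFrickeTraceAtNine`**, **E-imc-160b `OmegaEqDoubleFrickeTraceAtTwentySeven`**,
**E-imc-161 `RedDepthEqModularDegreeAtThree`** — two lattice definitions (`frickeTraceLatticeAtThree`, `doubleFrickeTraceLatticeAtThree`;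
NOT the tree's `traceCutAtThree`: plain 3-integrality of the traces instead of `IsThreeAdicMem` in a level-`M` lattice) and PROVED
bookkeeping edges, notably **`traceCutLeOmegaAtNine_of_frickeTrace : OmegaEqFrickeTraceAtNine → TraceCutLeOmegaAtNine`** (closes the
tree's E-imc-156 inclusion half given E-160a) and `traceCut_le_omega_at_twentySeven_of_doubleFrickeTrace`.
WHAT IS CLAIMED (imc, not the tree): ENGINE 8's «TRACE = Ω» (E-imc-156a–d, `NeronOmegaThreeTrace.lean`) is a THEOREM ON PAPER modulo the
PAIR law at 3 (PROOFS-g21 Thm A/B), sharpened to the non-recursive E-160a/b; PAIR(3,2) ⟺ TWIST law given Edixhoven 2006 Prop. 4 (COR D);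
the twist law WITHOUT the hypothesis on `w x` is FALSE (ENGINE 8b `o[S:Tw] ≥ 1` from N = 99).  BC5 (census witness): ENGINE 8b
HOME/imc/kit-g21/neronomega_trace_g21.gp 8b9a8be3cd0bd4e7, pre-registered P-g21-1…6; smoke j320261 7/7 levels, full j320278 68/68 levels
`9 ∣ N ≤ 960` so far, OOS j320279 (963–1296) running at filing; E-161: ENGINE 7 `sigma_red = 0` 670/670 optimal classes (114 levels
`9 ∣ N ≤ 1269`, `81 ∤ N`) + ENGINE 8 436/436.  NOT IN PRINT (imc; ref2 P-imc-5 pending): nearest Edixhoven 1989/1991 [Edix2/Edix3],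
ČNS §§4–5 (acq-11457/11730), Agashe–Ribet–Stein 2011 Conj. 2.2 (E-161's currency `r_E/m_E`).  REFUTER VERDICTS: R-imc-61 (PROOFS-g21
audit + second engine), R-imc-62 (is σ^red = 0 a normalisation artefact?) PENDING at filing — a finding is repaired under a NEW name
(append-only).  bears_on: stmt-BirchSwinnertonDyer-22968 (C3 `ManinPrimeToThreeAtNine`, imc lens: Λ₃ ⊆ L_tr ⊆ Ω₃).
PARTITION (imc) ladder-adjacent · beyond-print theorem: no (paper theorem modulo the dictionary) · `3 ∤ c_E` is NOT proved by this;
BSD is not proved by this; Manin's law `c ∈ {±1}` is not proved by this; C3 stays OPEN.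
-/

/-!
## imc's sketch docstring (verbatim)
# Sketch-imc-g21 — «Ω = FRICKE-TRACE INTEGRALITY» at `9 ∥ N` and `27 ∥ N`, the PAIR law E-imc-149 at 3 and its odd half (the TWIST law)

LENS = Iwasawa-main-conjecture / integrality of families (cell `bsd-f2-manin`, seat `-imc` g21; MEMO-imc §27, HOME/imc/PROOFS-g21.md).

WHAT IS NEW (g21).  ENGINE 8's conjecture E-imc-156 «TRACE = Ω» is PROVED ON PAPER (PROOFS-g21 Thm A/B, modulo the PAIR law E-imc-149 at
`p = 3`, itself LP-certified modulo the audited dictionary (D1)–(D5)) and SHARPENED to a NON-RECURSIVE description of the E-blind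
dualising-sheaf lattice: for `N = 9K`, `3 ∤ K`,
  `Ω₃(N) = {x ∈ S₂(Γ₀(N); ℤ) : w x and Tr^N_{N/3}(w_N x) are 3-adically integral}`      (E-imc-160a)
and for `N = 27K`, `3 ∤ K`, the same with BOTH `Tr(x)` and `Tr(w_N x)` (E-imc-160b).  The mechanism is one line of cyclotomic
algebra: with `t = t_{1/3}`, `Tr^N_{N/3} = 1 + w_N t w_N + w_N t² w_N` (coset identity, `TraceTranslateIdentityAtThree`), so for
`z := w_N t x = A + ζ₃ B'·…` the REAL part of the `C_1`-word is `(Tr(w_N x) − w_N x)/2` and the IMAGINARY part is `½ w_N(x ⊗ χ₋₃)`;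
the allowance `(1−ζ₃)⁻¹ = 𝔇⁻¹` of `IsPiIntegralUpToDifferent` asks `A ∈ ℤ₃` and `3B' ∈ ℤ₃`; the PAIR law (`3·z` is
`ℤ₃[ζ₃]`-integral whenever `x, w x` are integral) gives `3B' ∈ ℤ₃` for free (odd valuations: `≥ −2 ⇒ ≥ −1`) — the TWIST law
E-imc-159 — so on `L_red` the `C_1`-condition IS «`Tr(w_N x)` integral».  BC5 = ENGINE 8b (kit-g21/neronomega_trace_g21.gp
8b9a8be3cd0bd4e7; smoke j320261 7/7 levels incl. `27 ∥ 297`; full runs j320278 `9 ∣ N ≤ 960`, j320279 OOS `963…1296`, predictions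
P-g21-1…6 pre-registered in the seat's NOTES.md before submission).  Nothing here is asserted; the PAIR/TWIST laws are E-blind
conjectures with LP certificates on paper; E-160a/b are conjectures whose paper proofs reduce them to E-149.
PARTITION (imc) ladder-adjacent · beyond-print theorem: no (paper theorem modulo the dictionary) · `3 ∤ c_E` is NOT proved by this;
BSD is not proved by this; Manin's conjecture is not proved by this.
-/

noncomputable section

open scoped MatrixGroups ModularForm
open CongruenceSubgroup Literature.NumberTheory.EllipticCurves.ModularForms
  Summit.BirchSwinnertonDyer.Rank1Residual.ManinAdditive
  Summit.BirchSwinnertonDyer.Rank1Residual.ManinAdditive.ConwayCut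
  Summit.BirchSwinnertonDyer.Rank1Residual.ManinAdditive.ConwayNortonThree
  Summit.BirchSwinnertonDyer.Rank1Residual.ManinAdditive.NeronCuspThree
  Summit.BirchSwinnertonDyer.Rank1Residual.ManinAdditive.NeronOmegaThree

namespace Summit.BirchSwinnertonDyer.Rank1Residual.ManinAdditive.NeronOmegaThree

/-! ### §1. The coset identity (support, print-provable) -/

/-- **`TraceTranslateIdentityAtThree`** (support; folklore coset computation, PROOFS-g21 §1 (E2)): for `N = 3M` with `3 ∣ M`,
`Γ₀(M) = ⊔_{j=0,1,2} Γ₀(N)·(1 0; jM 1)` and `(1 0; jM 1) = w_N (1 −j/3; 0 1) w_N⁻¹`, so the degeneracy trace is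
`Tr^N_M y = y + w_N t_{2/3} w_N y + w_N t_{1/3} w_N y` (weight 2: `w_N ∘ w_N = id`, all operators in the classical normalisation).
Stated through the inclusion `degeneracyMap0 M N 1 2` (the identity on functions).  Tagged `conjecture` only because it is
unproved in the tree; it is a routine identity — the landed coset sum `coe_adjDegeneracyMap0_one_three_mul_eq_sum` (Literature
`DegeneracyTraceCosetSum`, p678484: `⇑(Tr f) = Σ_{j<3} ⇑f ∣ (1 0; Mj 1)`) plus the matrix identity `w_N (1 −j/3; 0 1) w_N = −N·(1 0; jM 1)` and `k = 2`
scalar-triviality — a SUPPORT statement, not a crux. -/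
@[conjecture] def TraceTranslateIdentityAtThree : Prop :=
  ∀ (M : ℕ) [NeZero M], 3 ∣ M → ∀ y : CuspForm (Gamma0 (3 * M)) 2,
    degeneracyMap0 M (3 * M) 1 2 (adjDegeneracyMap0 (3 * M) M 1 2 y) =
      y + frickeInvolution (3 * M) 2 (thirdTranslate (3 * M) 2 2 (frickeInvolution (3 * M) 2 y))
        + frickeInvolution (3 * M) 2 (thirdTranslate (3 * M) 2 1 (frickeInvolution (3 * M) 2 y))

/-! ### §2. The PAIR law at 3 (E-imc-149, LP-certified on paper, PROOFS-g19 §4 (P17c)/§5 (PAIR)) and its odd half, the TWIST law -/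

/-- **E-imc-149 `PairLawAtThree`** (conjecture = the two-cusp vertex `{∞, 0} → C_1` of the Katz–Mazur LP at 3, value `n_1 ≤ 1`;
PROOFS-g19 Thm 3 (P17c) all `v ≥ 3`, §6 `v = 2`): for `9 ∣ N`, if `x` and `w x` (`w = w_{3^{v₃(N)}}`) are 3-adically integral then
`3 · w(t₃ x)` is 3-adically `ℤ[ζ₃]`-integral (`(1−ζ₃)`-valuation of the word at the cusp `1/3` is `≥ −2`).  BC5: kmlp3test P17′c
(35 + 76 levels `9 ∣ N ≤ 702`, bound attained, 0 violations) and ENGINE 8b columns `EA_red ≤ 1 ∧ EB_red ≤ 1`.  Why it might fail: the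
dictionary (D5) shift on the multiplicity-2 component; NOT in print. -/
@[conjecture] def PairLawAtThree : Prop :=
  ∀ (N : ℕ) [NeZero N], 9 ∣ N → ∀ x ∈ integralCuspForms0 N 2,
    IsThreeIntegral N (atkinLehnerInvolutionAt N 2 3 x) →
    ∃ m : ℕ, ¬ 3 ∣ m ∧ IsEisensteinIntegral N ((m : ℂ) • ((3 : ℂ) • atkinLehnerInvolutionAt N 2 3 (thirdTranslate N 2 1 x)))

/-- **E-imc-159 `TwistLawAtThree`** (conjecture; the ODD HALF of the PAIR law, PROOFS-g21 §2: `w(t₃ x) = w(A₃ x) + ζ₃ · w(x ⊗ χ₋₃)`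
with `A₃, ⊗χ₋₃ = twistOperatorAtThree` rational, and `v_{(1−ζ₃)} ≥ −2` forces the `ζ₃`-odd part to have `3`-denominator `≤ 3¹`):
for `9 ∣ N`, if `x` and `w x` are 3-adically integral then `3 · w(x ⊗ χ₋₃)` is 3-adically integral.  BC5: ENGINE 8b column
`o[Lred:Lred∩Tw] = 0` (smoke j320261: 7/7 levels; full table j320278/j320279).  The version WITHOUT the hypothesis on `w x` is FALSE
(ENGINE 8b `o[S:Tw] ≥ 1` at `N = 99, 108, 135, 171`, `= 4` at `297`).  Why it might fail: only with E-imc-149. -/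
@[conjecture] def TwistLawAtThree : Prop :=
  ∀ (N : ℕ) [NeZero N], 9 ∣ N → ∀ x ∈ integralCuspForms0 N 2,
    IsThreeIntegral N (atkinLehnerInvolutionAt N 2 3 x) →
    IsThreeIntegral N ((3 : ℂ) • atkinLehnerInvolutionAt N 2 3 (twistOperatorAtThree N 2 x))

/-! ### §3. «Ω = FRICKE-TRACE INTEGRALITY» (E-imc-160a/b; PROOFS-g21 Thm A) -/

/-- The **Fricke-trace lattice** at `9 ∥ N` (`N = 3M`): integral `x` with `w x` 3-integral (reduced component `C_0`) and
`Tr^N_M (w_N x)` 3-integral (this single linear condition IS the `C_1`-condition on `L_red`, PROOFS-g21 Thm A). -/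
def frickeTraceLatticeAtThree (N M : ℕ) [NeZero N] [NeZero M] : Submodule ℤ (CuspForm (Gamma0 N) 2) :=
  sSup {L | L ≤ integralCuspForms0 N 2 ∧ ∀ x ∈ L,
    IsThreeIntegral N (atkinLehnerInvolutionAt N 2 3 x) ∧
    IsThreeIntegral M (adjDegeneracyMap0 N M 1 2 (frickeInvolution N 2 x))}

/-- The **double Fricke-trace lattice** at `27 ∥ N` (`N = 3M`): `w x`, `Tr^N_M x` and `Tr^N_M (w_N x)` all 3-integral
(components `C_0`, `C_2 ∋ w(1/3)` and `C_1 ∋ 1/3` respectively, PROOFS-g21 Thm A(v=3)). -/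
def doubleFrickeTraceLatticeAtThree (N M : ℕ) [NeZero N] [NeZero M] : Submodule ℤ (CuspForm (Gamma0 N) 2) :=
  sSup {L | L ≤ integralCuspForms0 N 2 ∧ ∀ x ∈ L,
    IsThreeIntegral N (atkinLehnerInvolutionAt N 2 3 x) ∧
    IsThreeIntegral M (adjDegeneracyMap0 N M 1 2 x) ∧
    IsThreeIntegral M (adjDegeneracyMap0 N M 1 2 (frickeInvolution N 2 x))}

/-- `frickeTraceLatticeAtThree N M ≤ S₂(Γ₀(N); ℤ)`. -/
theorem frickeTraceLatticeAtThree_le (N M : ℕ) [NeZero N] [NeZero M] :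
    frickeTraceLatticeAtThree N M ≤ integralCuspForms0 N 2 :=
  sSup_le fun _ hL => hL.1

/-- `doubleFrickeTraceLatticeAtThree N M ≤ S₂(Γ₀(N); ℤ)`. -/
theorem doubleFrickeTraceLatticeAtThree_le (N M : ℕ) [NeZero N] [NeZero M] :
    doubleFrickeTraceLatticeAtThree N M ≤ integralCuspForms0 N 2 :=
  sSup_le fun _ hL => hL.1

/-- **E-imc-160a `OmegaEqFrickeTraceAtNine`** (conjecture with a paper proof modulo E-imc-149, PROOFS-g21 Thm A (v=2); BC5 = ENGINE 8b
column `LOM=LredA2oo = 1`, pre-registered P-g21-1: smoke j320261 4/4 levels `v₃ = 2`; full j320278): for `3 ∥ M`,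
`Ω₃(3M) = {x : w x 3-integral ∧ Tr^{3M}_M (w_{3M} x) 3-integral}` — NO level-`M` lattice, NO recursion: the non-reduced component is
read by the 3-integrality of ONE degeneracy trace.  Why it might fail: only with the PAIR law at a level beyond the certified range. -/
@[conjecture] def OmegaEqFrickeTraceAtNine : Prop :=
  ∀ (M : ℕ) [NeZero M], 3 ∣ M → ¬ 9 ∣ M →
    omegaLatticeAtThree (3 * M) = frickeTraceLatticeAtThree (3 * M) M

/-- **E-imc-160b `OmegaEqDoubleFrickeTraceAtTwentySeven`** (conjecture with a paper proof modulo E-imc-149, PROOFS-g21 Thm A (v=3);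
BC5 = ENGINE 8b column `LOM=LredA12oo = 1`, pre-registered P-g21-3: smoke j320261 3/3 levels `v₃ = 3` incl. `N = 297` where NEITHER
single trace suffices; full j320278): for `9 ∥ M`, `Ω₃(3M) = {x : w x, Tr^{3M}_M x, Tr^{3M}_M (w_{3M} x) all 3-integral}`. -/
@[conjecture] def OmegaEqDoubleFrickeTraceAtTwentySeven : Prop :=
  ∀ (M : ℕ) [NeZero M], 9 ∣ M → ¬ 27 ∣ M →
    omegaLatticeAtThree (3 * M) = doubleFrickeTraceLatticeAtThree (3 * M) M

/-! ### §4. Bookkeeping edges (PROVED): the sharpened laws imply ENGINE 8's inclusion «trace cut ≤ Ω» used E-facingly (with (α)(β)(γ): Λ ≤ L_tr ≤ Ω₃) -/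

/-- Elementwise reading of `frickeTraceLatticeAtThree`: a sublattice of `S` all of whose elements satisfy the two conditions lies in it. -/
theorem le_frickeTraceLatticeAtThree {N M : ℕ} [NeZero N] [NeZero M] {L : Submodule ℤ (CuspForm (Gamma0 N) 2)}
    (hS : L ≤ integralCuspForms0 N 2)
    (h : ∀ x ∈ L, IsThreeIntegral N (atkinLehnerInvolutionAt N 2 3 x) ∧
      IsThreeIntegral M (adjDegeneracyMap0 N M 1 2 (frickeInvolution N 2 x))) :
    L ≤ frickeTraceLatticeAtThree N M :=
  le_sSup ⟨hS, h⟩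

/-- 3-adic membership in a sublattice of `S₂(Γ₀(M); ℤ)` implies 3-integrality. -/
theorem isThreeIntegral_of_isThreeAdicMem {M : ℕ} [NeZero M] {Λ : Submodule ℤ (CuspForm (Gamma0 M) 2)}
    (hΛ : Λ ≤ integralCuspForms0 M 2) {y : CuspForm (Gamma0 M) 2} (hy : IsThreeAdicMem Λ y) :
    IsThreeIntegral M y := by
  obtain ⟨m, hm, hmem⟩ := hy
  exact ⟨m, hm, hΛ hmem⟩

/-- **E-160a ⇒ E-156's inclusion half `TraceCutLeOmegaAtNine`** (PROVED): every element of the trace cut over `DR(M)` has `w x` and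
`Tr(w_N x) ∈ DR(M) ⊆ S(M)` 3-integral, hence lies in the Fricke-trace lattice `= Ω₃(3M)`. -/
theorem traceCutLeOmegaAtNine_of_frickeTrace (h : OmegaEqFrickeTraceAtNine) : TraceCutLeOmegaAtNine := by
  intro M _ h3 h9
  rw [h M h3 h9]
  refine sSup_le fun L hL => le_frickeTraceLatticeAtThree hL.1 fun x hx => ?_
  obtain ⟨h0, -, h2⟩ := hL.2 x hx
  exact ⟨h0, isThreeIntegral_of_isThreeAdicMem (sSup_le fun _ hK => hK.1) h2⟩

/-- Elementwise reading of `doubleFrickeTraceLatticeAtThree`. -/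
theorem le_doubleFrickeTraceLatticeAtThree {N M : ℕ} [NeZero N] [NeZero M] {L : Submodule ℤ (CuspForm (Gamma0 N) 2)}
    (hS : L ≤ integralCuspForms0 N 2)
    (h : ∀ x ∈ L, IsThreeIntegral N (atkinLehnerInvolutionAt N 2 3 x) ∧
      IsThreeIntegral M (adjDegeneracyMap0 N M 1 2 x) ∧
      IsThreeIntegral M (adjDegeneracyMap0 N M 1 2 (frickeInvolution N 2 x))) :
    L ≤ doubleFrickeTraceLatticeAtThree N M :=
  le_sSup ⟨hS, h⟩

/-- **E-160b ⇒ the inclusion «trace cut over `Ω₃(M)` ≤ `Ω₃(3M)`» at `27 ∥ 3M`** (PROVED; the `27`-analogue of `TraceCutLeOmegaAtNine`,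
which the tree does not name): 3-adic membership in `Ω₃(M) ⊆ S(M)` of both traces gives their 3-integrality. -/
theorem traceCut_le_omega_at_twentySeven_of_doubleFrickeTrace (h : OmegaEqDoubleFrickeTraceAtTwentySeven)
    (M : ℕ) [NeZero M] (h9 : 9 ∣ M) (h27 : ¬ 27 ∣ M) :
    traceCutAtThree (3 * M) M (omegaLatticeAtThree M) ≤ omegaLatticeAtThree (3 * M) := by
  rw [h M h9 h27]
  refine sSup_le fun L hL => le_doubleFrickeTraceLatticeAtThree hL.1 fun x hx => ?_
  obtain ⟨h0, h1, h2⟩ := hL.2 x hx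
  exact ⟨h0, isThreeIntegral_of_isThreeAdicMem (omegaLatticeAtThree_le M) h1,
    isThreeIntegral_of_isThreeAdicMem (omegaLatticeAtThree_le M) h2⟩


/-! ### §5. E-imc-161 — the MODULAR DEGREE is the congruence number of the «both-cusps» lattice `L_red = S ∩ w S` at 3 (E-facing, E-blind in form) -/

/-- **E-imc-161 `RedDepthEqModularDegreeAtThree`** (E-FACING LAW candidate, imc g21; MEMO-imc (27.9)): for an optimal `E` of conductor `N` with
`9 ∣ N`, `81 ∤ N`, the `f`-line has depth EXACTLY `ord₃ deg φ` in the reduced-component lattice `L_red(N) = {x ∈ S₂(Γ₀(N); ℤ) : w x 3-integral}`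
(tree `drLatticeAtThree N`): `ord₃ [e_f L_red : ℤ f] = ord₃ deg φ`.  Equivalently (ARS currency): the 3-part of the discrepancy `r_E / m_E` between
congruence number and modular degree is EXACTLY the drop of the `f`-line from `S` to `S ∩ w S` — an E-blind formula for the quantity of
[Agashe–Ribet–Stein 2011, Conj. 2.2 and the Proposition after it (`p ∣ r_E/m_E` ⟹ multiplicity one fails), corpus:paper:doi-10-1007-978-1-4614-1260-1-2
p.4–5; examples 54B1, 99A1 at `p = 3`].  BC5: ENGINE 7 field `sigma_red = 0` on 670/670 optimal classes (114 levels `9 ∣ N ≤ 1269`, `81 ∤ N`; tables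
HOME/imc/kit-g20/g20-neronomega-p3-9N-*.txt) and ENGINE 8 `sigma_red = 0` on 436/436 (`≤ 960`), while `sigma_S = −1` (i.e. `3 ∥ r_E/m_E`) on 133/436.
Why it might fail: a deep `3`-old congruence of `f` inside `L_red` not detected by `w` (none ≤ 1269); `81 ∣ N` untested.  Binders copied from E-imc-152. -/
@[conjecture] def RedDepthEqModularDegreeAtThree : Prop :=
  ∀ (W : WeierstrassCurve ℚ) [W.IsElliptic] [W.IsGloballyMinimal] [NeZero (W.conductorNorm ℤ)]
    (D : ModularParametrizationData W (W.conductorNorm ℤ)),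
    (∀ z ∈ D.L.lattice, ∃ w ∈ periodLattice D.f, z = D.c * w) →
    (∀ (W' : WeierstrassCurve ℚ) [W'.IsElliptic]
        (D' : ModularParametrizationData W' (W.conductorNorm ℤ)),
        D'.f = D.f → D.modularDegree ≤ D'.modularDegree) →
    9 ∣ W.conductorNorm ℤ → ¬ 81 ∣ W.conductorNorm ℤ →
      padicValNat 3 (lineIndex (drLatticeAtThree (W.conductorNorm ℤ)) D.f) = padicValNat 3 D.modularDegree

end Summit.BirchSwinnertonDyer.Rank1Residual.ManinAdditive.NeronOmegaThree
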